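import Mathlib
import HarnessLib
import Summits.HubbardSuperconductivity.HubbardSuperconductivity.Theorems.KLProgrammeKLRegimeEngineLatticeCellVolumeLower

/-!
# Route `KLProgramme` — ENGINE (stmt-HubbardSuperconductivity-20437 `KLRegimeEngineV17F2`), cure (C′) of located #22, brick O3 part 2:
# the LATTICE two-sided shell asymmetry of a planar band is at most `(L/2π)²·(CONTINUUM asymmetry + four thin shells)`
# (cell gate-hubbard-kl, seat hubbard-kl-k3c2-p2 g31, technique «thermal-bar induction n ≤ nScales β + 1 with EngineBoundsAtV4S sums»)

WHY.  Brick O2 (`…SplitBornOddnessLayer.klol_abs_sum_odd_le`) bounds the localised born sum of the self-energy line by `Λ·C_f·A`, `A` a bound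
on the TWO-SIDED SHELL ASYMMETRY `#{k̃ : t < e(p_k̃) ≤ Λ} − #{k̃ : −Λ ≤ e(p_k̃) < −t}` (`t ∈ [0, Λ]`) of the levels `e(p_k̃)` of a planar band
`e : ℝ × ℝ → ℝ` at the torus momenta `p_k̃ = 2πk̃/L`.  The main terms of the two one-sided counts CANCEL, so the lattice ↔ volume comparison
must be exact (factor `1`) in BOTH directions: the cells `p_k̃ + [0, 2π/L)²` of ALL torus momenta tile the half-open square `[0, 2π)²`
exactly (`cell_subset_sq` here, `exists_mem_cell_of_mem_square` in part 1), so — with `δ` the oscillation of `e` on a cell —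

* §2 `card_filter_mul_sq_le_volume_of_osc` — `#{k̃ : P(e(p_k̃))}·(2π/L)² ≤ vol{q ∈ [0,2π)² : Q(e q)}` whenever `Q` is the `δ`-FATTENING of `P`
  (`…TwoShellLatticeCount.card_mul_le_volume_of_cells`), and `volume_le_card_filter_mul_sq_of_osc` — `vol{q ∈ [0,2π)² : Q′(e q)} ≤ #·(2π/L)²`
  whenever `Q′` is the `δ`-THINNING of `P` (part 1, `volume_le_card_filter_mul_of_thin`); real-valued forms;
* §3 **`abs_card_sub_card_shell_le_of_volumes`** — if every closed thin shell `{a ≤ e ≤ b}` of `[0,2π)²` inside `[−Λ−δ, Λ+δ]` has volume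
  `≤ D·(b − a)` (density of states) and the CONTINUUM asymmetry `|vol{t < e ≤ Λ} − vol{−Λ ≤ e < −t}| ≤ A_c` on `[0, Λ]`, then
  `|#{t < e(p_k̃) ≤ Λ} − #{−Λ ≤ e(p_k̃) < −t}| ≤ (L/2π)²·(A_c + 4·D·δ)` for every `t ∈ [0, Λ]` — the `c₁·N′·Λ²·L² + c₂·G·L` shape of
  CURE-C-PRIME-DESIGN §3 once `A_c ≲ N′Λ²` and `δ = G·2π/L`;
* §4 `volume_sep_sq_eq_volume_openSq_of_periodic` — for a doubly `2π`-periodic band the `[0,2π)²`-volumes above equal the volumes in the OPEN square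
  `(−π,π)²`, the window in which the co-moving chart of `…C4aLevelChartImage` computes them (part 3).
Pure measure theory on the torus cells; nothing about the model; nothing asserts (c), K3 or superconductivity.  [cite: FeldmanSalmhoferTrubowitz1998, App. B]
-/

noncomputable section

namespace Summit.HubbardSuperconductivity.HubbardSuperconductivity.Theorems.EngineV8

set_option linter.dupNamespace false -- summit = problem name (single-conjunct summit), D-0017

open Real Set MeasureTheory Finset
open scoped ENNReal
open Literature.MathematicalPhysics.QuantumLattice Literature.Probability.LatticeModels

/-! ## §1 Cells lie in the half-open square `[0, 2π)²`; sets in the square have finite volume -/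

/-- Every cell `p_k̃ + [0, 2π/L)²` lies in the half-open square `[0, 2π)²` (`k̃_i ≤ L − 1`). -/
theorem cell_subset_sq {L : ℕ} [NeZero L] (k : TorusSite 2 L) :
    Ico (latticeMomentum L k 0) (latticeMomentum L k 0 + 2 * π / L) ×ˢ Ico (latticeMomentum L k 1) (latticeMomentum L k 1 + 2 * π / L) ⊆
      Ico (0 : ℝ) (2 * π) ×ˢ Ico (0 : ℝ) (2 * π) := by
  have hL : (0 : ℝ) < L := by exact_mod_cast Nat.pos_of_ne_zero (NeZero.ne L)
  have hval : ∀ i : Fin 2, latticeMomentum L k i + 2 * π / L ≤ 2 * π := by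
    intro i
    have h1 : ((k i).val : ℝ) + 1 ≤ L := by exact_mod_cast ZMod.val_lt (k i)
    show 2 * π * ((k i).val : ℝ) / L + 2 * π / L ≤ 2 * π
    rw [← add_div, div_le_iff₀ hL]; nlinarith [Real.pi_pos]
  have h0 : ∀ i : Fin 2, 0 ≤ latticeMomentum L k i := fun i => show 0 ≤ 2 * π * ((k i).val : ℝ) / L by positivity
  intro p hp
  simp only [Set.mem_prod, Set.mem_Ico] at hp ⊢
  obtain ⟨⟨h1a, h1b⟩, ⟨h2a, h2b⟩⟩ := hp
  exact ⟨⟨(h0 0).trans h1a, h1b.trans_le (hval 0)⟩, ⟨(h0 1).trans h2a, h2b.trans_le (hval 1)⟩⟩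

/-- The half-open square `[0, 2π)²` has volume `(2π)²`. -/
theorem volume_sq_eq : volume (Ico (0 : ℝ) (2 * π) ×ˢ Ico (0 : ℝ) (2 * π)) = ENNReal.ofReal ((2 * π) ^ 2) := by
  rw [Measure.volume_eq_prod, Measure.prod_prod, Real.volume_Ico, sub_zero, ← ENNReal.ofReal_mul (by positivity), sq]

/-- A subset of the square selected by a predicate has finite volume. -/
theorem volume_sep_sq_lt_top (S : ℝ × ℝ → Prop) : volume {q ∈ Ico (0 : ℝ) (2 * π) ×ˢ Ico (0 : ℝ) (2 * π) | S q} < ∞ :=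
  (measure_mono (fun q hq => hq.1)).trans_lt (by rw [volume_sq_eq]; exact ENNReal.ofReal_lt_top)

/-- Subadditivity over three pieces, real-valued: if `S ⇒ S₁ ∨ S₂ ∨ S₃` on the square then
`vol{S}.toReal ≤ vol{S₁}.toReal + vol{S₂}.toReal + vol{S₃}.toReal`. -/
theorem toReal_volume_sep_sq_le_add_three {S S₁ S₂ S₃ : ℝ × ℝ → Prop} (h : ∀ q, S q → S₁ q ∨ S₂ q ∨ S₃ q) :
    (volume {q ∈ Ico (0 : ℝ) (2 * π) ×ˢ Ico (0 : ℝ) (2 * π) | S q}).toReal ≤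
      (volume {q ∈ Ico (0 : ℝ) (2 * π) ×ˢ Ico (0 : ℝ) (2 * π) | S₁ q}).toReal +
        (volume {q ∈ Ico (0 : ℝ) (2 * π) ×ˢ Ico (0 : ℝ) (2 * π) | S₂ q}).toReal +
        (volume {q ∈ Ico (0 : ℝ) (2 * π) ×ˢ Ico (0 : ℝ) (2 * π) | S₃ q}).toReal := by
  have hsub : {q ∈ Ico (0 : ℝ) (2 * π) ×ˢ Ico (0 : ℝ) (2 * π) | S q} ⊆
      ({q ∈ Ico (0 : ℝ) (2 * π) ×ˢ Ico (0 : ℝ) (2 * π) | S₁ q} ∪ {q ∈ Ico (0 : ℝ) (2 * π) ×ˢ Ico (0 : ℝ) (2 * π) | S₂ q}) ∪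
        {q ∈ Ico (0 : ℝ) (2 * π) ×ˢ Ico (0 : ℝ) (2 * π) | S₃ q} := by
    intro q hq
    rcases h q hq.2 with h1 | h2 | h3
    · exact Or.inl (Or.inl ⟨hq.1, h1⟩)
    · exact Or.inl (Or.inr ⟨hq.1, h2⟩)
    · exact Or.inr ⟨hq.1, h3⟩
  have hle : volume {q ∈ Ico (0 : ℝ) (2 * π) ×ˢ Ico (0 : ℝ) (2 * π) | S q} ≤
      (volume {q ∈ Ico (0 : ℝ) (2 * π) ×ˢ Ico (0 : ℝ) (2 * π) | S₁ q} + volume {q ∈ Ico (0 : ℝ) (2 * π) ×ˢ Ico (0 : ℝ) (2 * π) | S₂ q}) +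
        volume {q ∈ Ico (0 : ℝ) (2 * π) ×ˢ Ico (0 : ℝ) (2 * π) | S₃ q} :=
    (measure_mono hsub).trans ((measure_union_le _ _).trans (add_le_add (measure_union_le _ _) le_rfl))
  have h1 := volume_sep_sq_lt_top S₁
  have h2 := volume_sep_sq_lt_top S₂
  have h3 := volume_sep_sq_lt_top S₃
  calc _ ≤ ((volume {q ∈ Ico (0 : ℝ) (2 * π) ×ˢ Ico (0 : ℝ) (2 * π) | S₁ q} +
        volume {q ∈ Ico (0 : ℝ) (2 * π) ×ˢ Ico (0 : ℝ) (2 * π) | S₂ q}) +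
        volume {q ∈ Ico (0 : ℝ) (2 * π) ×ˢ Ico (0 : ℝ) (2 * π) | S₃ q}).toReal :=
        ENNReal.toReal_mono (ENNReal.add_ne_top.2 ⟨ENNReal.add_ne_top.2 ⟨h1.ne, h2.ne⟩, h3.ne⟩) hle
    _ = _ := by rw [ENNReal.toReal_add (ENNReal.add_ne_top.2 ⟨h1.ne, h2.ne⟩) h3.ne, ENNReal.toReal_add h1.ne h2.ne]

/-! ## §2 One-sided lattice counts against fattened / thinned shell volumes (both directions, factor `1`) -/

/-- **Upper count (fattening)**: if `e` oscillates by at most `δ` on every cell and `Q` holds at every point within `δ` of a point where `P`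
holds, then `#{k̃ : P(e(p_k̃))}·(2π/L)² ≤ vol{q ∈ [0,2π)² : Q(e q)}`. [cite: FeldmanSalmhoferTrubowitz1998, App. B] -/
theorem card_filter_mul_sq_le_volume_of_osc {L : ℕ} [NeZero L] (e : ℝ × ℝ → ℝ) {δ : ℝ}
    (hosc : ∀ k : TorusSite 2 L, ∀ q ∈ Ico (latticeMomentum L k 0) (latticeMomentum L k 0 + 2 * π / L) ×ˢ
      Ico (latticeMomentum L k 1) (latticeMomentum L k 1 + 2 * π / L), |e q - e (latticeMomentum L k 0, latticeMomentum L k 1)| ≤ δ)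
    (P Q : ℝ → Prop) [DecidablePred P] (hPQ : ∀ x y, |x - y| ≤ δ → P y → Q x) :
    ((univ.filter fun k : TorusSite 2 L => P (e (latticeMomentum L k 0, latticeMomentum L k 1))).card : ℝ≥0∞) *
        ENNReal.ofReal ((2 * π / L) ^ 2) ≤
      volume {q ∈ Ico (0 : ℝ) (2 * π) ×ˢ Ico (0 : ℝ) (2 * π) | Q (e q)} :=
  card_mul_le_volume_of_cells _ _ fun k hk q hq => ⟨cell_subset_sq k hq, hPQ _ _ (hosc k q hq) (Finset.mem_filter.1 hk).2⟩

/-- **Lower count (thinning)**: if `e` oscillates by at most `δ` on every cell and `P` holds at every point within `δ` of a point where `Q′`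
holds, then `vol{q ∈ [0,2π)² : Q′(e q)} ≤ #{k̃ : P(e(p_k̃))}·(2π/L)²`. -/
theorem volume_le_card_filter_mul_sq_of_osc {L : ℕ} [NeZero L] (e : ℝ × ℝ → ℝ) {δ : ℝ}
    (hosc : ∀ k : TorusSite 2 L, ∀ q ∈ Ico (latticeMomentum L k 0) (latticeMomentum L k 0 + 2 * π / L) ×ˢ
      Ico (latticeMomentum L k 1) (latticeMomentum L k 1 + 2 * π / L), |e q - e (latticeMomentum L k 0, latticeMomentum L k 1)| ≤ δ)
    (P Q' : ℝ → Prop) [DecidablePred P] (hQP : ∀ x y, |x - y| ≤ δ → Q' x → P y) :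
    volume {q ∈ Ico (0 : ℝ) (2 * π) ×ˢ Ico (0 : ℝ) (2 * π) | Q' (e q)} ≤
      ((univ.filter fun k : TorusSite 2 L => P (e (latticeMomentum L k 0, latticeMomentum L k 1))).card : ℝ≥0∞) *
        ENNReal.ofReal ((2 * π / L) ^ 2) :=
  volume_le_card_filter_mul_of_thin _ (fun _ hq => hq.1) fun k q hq hcell => hQP _ _ (hosc k q hcell) hq.2

/-- Real-valued upper count: `#{k̃ : P(e(p_k̃))}·(2π/L)² ≤ (vol{q ∈ [0,2π)² : Q(e q)}).toReal`. -/
theorem card_filter_mul_sq_le_toReal_volume_of_osc {L : ℕ} [NeZero L] (e : ℝ × ℝ → ℝ) {δ : ℝ}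
    (hosc : ∀ k : TorusSite 2 L, ∀ q ∈ Ico (latticeMomentum L k 0) (latticeMomentum L k 0 + 2 * π / L) ×ˢ
      Ico (latticeMomentum L k 1) (latticeMomentum L k 1 + 2 * π / L), |e q - e (latticeMomentum L k 0, latticeMomentum L k 1)| ≤ δ)
    (P Q : ℝ → Prop) [DecidablePred P] (hPQ : ∀ x y, |x - y| ≤ δ → P y → Q x) :
    ((univ.filter fun k : TorusSite 2 L => P (e (latticeMomentum L k 0, latticeMomentum L k 1))).card : ℝ) * (2 * π / L) ^ 2 ≤
      (volume {q ∈ Ico (0 : ℝ) (2 * π) ×ˢ Ico (0 : ℝ) (2 * π) | Q (e q)}).toReal := by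
  have h := ENNReal.toReal_mono (volume_sep_sq_lt_top (fun q => Q (e q))).ne (card_filter_mul_sq_le_volume_of_osc e hosc P Q hPQ)
  rwa [ENNReal.toReal_mul, ENNReal.toReal_natCast, ENNReal.toReal_ofReal (sq_nonneg _)] at h

/-- Real-valued lower count: `(vol{q ∈ [0,2π)² : Q′(e q)}).toReal ≤ #{k̃ : P(e(p_k̃))}·(2π/L)²`. -/
theorem toReal_volume_le_card_filter_mul_sq_of_osc {L : ℕ} [NeZero L] (e : ℝ × ℝ → ℝ) {δ : ℝ}
    (hosc : ∀ k : TorusSite 2 L, ∀ q ∈ Ico (latticeMomentum L k 0) (latticeMomentum L k 0 + 2 * π / L) ×ˢ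
      Ico (latticeMomentum L k 1) (latticeMomentum L k 1 + 2 * π / L), |e q - e (latticeMomentum L k 0, latticeMomentum L k 1)| ≤ δ)
    (P Q' : ℝ → Prop) [DecidablePred P] (hQP : ∀ x y, |x - y| ≤ δ → Q' x → P y) :
    (volume {q ∈ Ico (0 : ℝ) (2 * π) ×ˢ Ico (0 : ℝ) (2 * π) | Q' (e q)}).toReal ≤
      ((univ.filter fun k : TorusSite 2 L => P (e (latticeMomentum L k 0, latticeMomentum L k 1))).card : ℝ) * (2 * π / L) ^ 2 := by
  have hfin : ((univ.filter fun k : TorusSite 2 L => P (e (latticeMomentum L k 0, latticeMomentum L k 1))).card : ℝ≥0∞) *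
      ENNReal.ofReal ((2 * π / L) ^ 2) ≠ ∞ := ENNReal.mul_ne_top (ENNReal.natCast_ne_top _) ENNReal.ofReal_ne_top
  have h := ENNReal.toReal_mono hfin (volume_le_card_filter_mul_sq_of_osc e hosc P Q' hQP)
  rwa [ENNReal.toReal_mul, ENNReal.toReal_natCast, ENNReal.toReal_ofReal (sq_nonneg _)] at h

/-! ## §3 The two-sided shell asymmetry: lattice ≤ `(L/2π)²·(continuum + four thin shells)` -/

/-- A closed thin shell of the square has real volume `≤ D·(b − a)` (real-valued reading of the density-of-states hypothesis). -/
theorem toReal_volume_shell_le {e : ℝ × ℝ → ℝ} {D a b : ℝ} (hD : 0 ≤ D) (hab : a ≤ b)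
    (h : volume {q ∈ Ico (0 : ℝ) (2 * π) ×ˢ Ico (0 : ℝ) (2 * π) | a ≤ e q ∧ e q ≤ b} ≤ ENNReal.ofReal (D * (b - a))) :
    (volume {q ∈ Ico (0 : ℝ) (2 * π) ×ˢ Ico (0 : ℝ) (2 * π) | a ≤ e q ∧ e q ≤ b}).toReal ≤ D * (b - a) :=
  ENNReal.toReal_le_of_le_ofReal (mul_nonneg hD (sub_nonneg.2 hab)) h

/-- **THE LATTICE SHELL ASYMMETRY.**  Let the planar band `e` oscillate by at most `δ ≥ 0` on every cell `p_k̃ + [0, 2π/L)²`; suppose every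
closed thin shell `{q ∈ [0,2π)² : a ≤ e q ≤ b}` with `−Λ − δ ≤ a ≤ b ≤ Λ + δ` has volume `≤ D·(b − a)` (`D ≥ 0`), and the CONTINUUM two-sided
asymmetry is at most `A_c`: `|vol{t < e ≤ Λ} − vol{−Λ ≤ e < −t}| ≤ A_c` for `t ∈ [0, Λ]`.  Then for every `t ∈ [0, Λ]`
`|#{k̃ : t < e(p_k̃) ≤ Λ} − #{k̃ : −Λ ≤ e(p_k̃) < −t}| ≤ (L/2π)²·(A_c + 4·D·δ)`. [cite: FeldmanSalmhoferTrubowitz1998, App. B] -/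
theorem abs_card_sub_card_shell_le_of_volumes {L : ℕ} [NeZero L] (e : ℝ × ℝ → ℝ) {δ D Ac Λ : ℝ} (hδ : 0 ≤ δ) (hD : 0 ≤ D)
    (hosc : ∀ k : TorusSite 2 L, ∀ q ∈ Ico (latticeMomentum L k 0) (latticeMomentum L k 0 + 2 * π / L) ×ˢ
      Ico (latticeMomentum L k 1) (latticeMomentum L k 1 + 2 * π / L), |e q - e (latticeMomentum L k 0, latticeMomentum L k 1)| ≤ δ)
    (hshell : ∀ a b : ℝ, -Λ - δ ≤ a → a ≤ b → b ≤ Λ + δ →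
      volume {q ∈ Ico (0 : ℝ) (2 * π) ×ˢ Ico (0 : ℝ) (2 * π) | a ≤ e q ∧ e q ≤ b} ≤ ENNReal.ofReal (D * (b - a)))
    (hAc : ∀ t ∈ Icc 0 Λ, |(volume {q ∈ Ico (0 : ℝ) (2 * π) ×ˢ Ico (0 : ℝ) (2 * π) | t < e q ∧ e q ≤ Λ}).toReal -
      (volume {q ∈ Ico (0 : ℝ) (2 * π) ×ˢ Ico (0 : ℝ) (2 * π) | -Λ ≤ e q ∧ e q < -t}).toReal| ≤ Ac) :
    ∀ t ∈ Icc 0 Λ, |((univ.filter fun k : TorusSite 2 L =>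
        t < e (latticeMomentum L k 0, latticeMomentum L k 1) ∧ e (latticeMomentum L k 0, latticeMomentum L k 1) ≤ Λ).card : ℝ) -
      ((univ.filter fun k : TorusSite 2 L =>
        -Λ ≤ e (latticeMomentum L k 0, latticeMomentum L k 1) ∧ e (latticeMomentum L k 0, latticeMomentum L k 1) < -t).card : ℝ)| ≤
      ((L : ℝ) / (2 * π)) ^ 2 * (Ac + 4 * D * δ) := by
  intro t ht
  have hL : (0 : ℝ) < L := by exact_mod_cast Nat.pos_of_ne_zero (NeZero.ne L)
  have hh : 0 < (2 * π / L) ^ 2 := by positivity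
  have ht0 : 0 ≤ t := ht.1
  have htΛ : t ≤ Λ := ht.2
  -- the eight thin shells (each of width `δ`, inside `[−Λ−δ, Λ+δ]`)
  have hs1 := toReal_volume_shell_le hD (show t - δ ≤ t by linarith) (hshell (t - δ) t (by linarith) (by linarith) (by linarith))
  have hs2 := toReal_volume_shell_le hD (show Λ ≤ Λ + δ by linarith) (hshell Λ (Λ + δ) (by linarith) (by linarith) le_rfl)
  have hs3 := toReal_volume_shell_le hD (show -Λ ≤ -Λ + δ by linarith) (hshell (-Λ) (-Λ + δ) (by linarith) (by linarith) (by linarith))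
  have hs4 := toReal_volume_shell_le hD (show -t - δ ≤ -t by linarith) (hshell (-t - δ) (-t) (by linarith) (by linarith) (by linarith))
  have hs5 := toReal_volume_shell_le hD (show -Λ - δ ≤ -Λ by linarith) (hshell (-Λ - δ) (-Λ) le_rfl (by linarith) (by linarith))
  have hs6 := toReal_volume_shell_le hD (show -t ≤ -t + δ by linarith) (hshell (-t) (-t + δ) (by linarith) (by linarith) (by linarith))
  have hs7 := toReal_volume_shell_le hD (show t ≤ t + δ by linarith) (hshell t (t + δ) (by linarith) (by linarith) (by linarith))
  have hs8 := toReal_volume_shell_le hD (show Λ - δ ≤ Λ by linarith) (hshell (Λ - δ) Λ (by linarith) (by linarith) (by linarith))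
  -- (1) N₊·h² ≤ vol{t−δ < e ≤ Λ+δ} ≤ Dδ + V₊ + Dδ
  have h1 := card_filter_mul_sq_le_toReal_volume_of_osc e hosc (fun y => t < y ∧ y ≤ Λ) (fun x => t - δ < x ∧ x ≤ Λ + δ)
    (fun x y hxy hy => by rw [abs_le] at hxy; exact ⟨by linarith [hy.1], by linarith [hy.2]⟩)
  have h1' := toReal_volume_sep_sq_le_add_three (S := fun q => t - δ < e q ∧ e q ≤ Λ + δ) (S₁ := fun q => t - δ ≤ e q ∧ e q ≤ t)
    (S₂ := fun q => t < e q ∧ e q ≤ Λ) (S₃ := fun q => Λ ≤ e q ∧ e q ≤ Λ + δ) (fun q hq => by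
      by_cases hq1 : e q ≤ t
      · exact Or.inl ⟨hq.1.le, hq1⟩
      · by_cases hq2 : e q ≤ Λ
        · exact Or.inr (Or.inl ⟨lt_of_not_ge hq1, hq2⟩)
        · exact Or.inr (Or.inr ⟨(lt_of_not_ge hq2).le, hq.2⟩))
  -- (2) vol{−Λ+δ ≤ e < −t−δ} ≤ N₋·h² and V₋ ≤ Dδ + that + Dδ
  have h2 := toReal_volume_le_card_filter_mul_sq_of_osc e hosc (fun y => -Λ ≤ y ∧ y < -t) (fun x => -Λ + δ ≤ x ∧ x < -t - δ)
    (fun x y hxy hx => by rw [abs_le] at hxy; exact ⟨by linarith [hx.1], by linarith [hx.2]⟩)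
  have h2' := toReal_volume_sep_sq_le_add_three (S := fun q => -Λ ≤ e q ∧ e q < -t) (S₁ := fun q => -Λ ≤ e q ∧ e q ≤ -Λ + δ)
    (S₂ := fun q => -Λ + δ ≤ e q ∧ e q < -t - δ) (S₃ := fun q => -t - δ ≤ e q ∧ e q ≤ -t) (fun q hq => by
      by_cases hq1 : e q ≤ -Λ + δ
      · exact Or.inl ⟨hq.1, hq1⟩
      · by_cases hq2 : e q < -t - δ
        · exact Or.inr (Or.inl ⟨(lt_of_not_ge hq1).le, hq2⟩)
        · exact Or.inr (Or.inr ⟨le_of_not_gt hq2, hq.2.le⟩))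
  -- (3) N₋·h² ≤ vol{−Λ−δ ≤ e < −t+δ} ≤ Dδ + V₋ + Dδ
  have h3 := card_filter_mul_sq_le_toReal_volume_of_osc e hosc (fun y => -Λ ≤ y ∧ y < -t) (fun x => -Λ - δ ≤ x ∧ x < -t + δ)
    (fun x y hxy hy => by rw [abs_le] at hxy; exact ⟨by linarith [hy.1], by linarith [hy.2]⟩)
  have h3' := toReal_volume_sep_sq_le_add_three (S := fun q => -Λ - δ ≤ e q ∧ e q < -t + δ) (S₁ := fun q => -Λ - δ ≤ e q ∧ e q ≤ -Λ)
    (S₂ := fun q => -Λ ≤ e q ∧ e q < -t) (S₃ := fun q => -t ≤ e q ∧ e q ≤ -t + δ) (fun q hq => by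
      by_cases hq1 : e q ≤ -Λ
      · exact Or.inl ⟨hq.1, hq1⟩
      · by_cases hq2 : e q < -t
        · exact Or.inr (Or.inl ⟨(lt_of_not_ge hq1).le, hq2⟩)
        · exact Or.inr (Or.inr ⟨le_of_not_gt hq2, hq.2.le⟩))
  -- (4) vol{t+δ < e ≤ Λ−δ} ≤ N₊·h² and V₊ ≤ Dδ + that + Dδ
  have h4 := toReal_volume_le_card_filter_mul_sq_of_osc e hosc (fun y => t < y ∧ y ≤ Λ) (fun x => t + δ < x ∧ x ≤ Λ - δ)
    (fun x y hxy hx => by rw [abs_le] at hxy; exact ⟨by linarith [hx.1], by linarith [hx.2]⟩)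
  have h4' := toReal_volume_sep_sq_le_add_three (S := fun q => t < e q ∧ e q ≤ Λ) (S₁ := fun q => t ≤ e q ∧ e q ≤ t + δ)
    (S₂ := fun q => t + δ < e q ∧ e q ≤ Λ - δ) (S₃ := fun q => Λ - δ ≤ e q ∧ e q ≤ Λ) (fun q hq => by
      by_cases hq1 : e q ≤ t + δ
      · exact Or.inl ⟨hq.1.le, hq1⟩
      · by_cases hq2 : e q ≤ Λ - δ
        · exact Or.inr (Or.inl ⟨lt_of_not_ge hq1, hq2⟩)
        · exact Or.inr (Or.inr ⟨(lt_of_not_ge hq2).le, hq.2⟩))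
  have hA := hAc t ht
  rw [abs_le] at hA
  set Np : ℝ := ((univ.filter fun k : TorusSite 2 L =>
        t < e (latticeMomentum L k 0, latticeMomentum L k 1) ∧ e (latticeMomentum L k 0, latticeMomentum L k 1) ≤ Λ).card : ℝ) with hNp
  set Nm : ℝ := ((univ.filter fun k : TorusSite 2 L =>
        -Λ ≤ e (latticeMomentum L k 0, latticeMomentum L k 1) ∧ e (latticeMomentum L k 0, latticeMomentum L k 1) < -t).card : ℝ) with hNm
  have hupper : (Np - Nm) * (2 * π / L) ^ 2 ≤ Ac + 4 * D * δ := by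
    rw [sub_mul]; linarith
  have hlower : (Nm - Np) * (2 * π / L) ^ 2 ≤ Ac + 4 * D * δ := by
    rw [sub_mul]; linarith
  -- convert `(L/2π)²·X = X / h²`
  have hconv : ((L : ℝ) / (2 * π)) ^ 2 * (Ac + 4 * D * δ) = (Ac + 4 * D * δ) / (2 * π / L) ^ 2 := by
    have hπ : (2 * π : ℝ) ≠ 0 := by positivity
    field_simp
  rw [hconv, abs_le]
  constructor
  · rw [neg_le, le_div_iff₀ hh, neg_sub]; exact hlower
  · rw [le_div_iff₀ hh]; exact hupper

/-! ## §4 Doubly `2π`-periodic sets: the `[0, 2π)²`-volume equals the volume in the open square `(−π, π)²` -/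

/-- First-coordinate shift: for `T` invariant under `(x, y) ↦ (x + 2π, y)` and a measurable second factor `J`,
`vol(([0,2π) × J) ∩ T) = vol(([−π,π) × J) ∩ T)` (the strip `[π, 2π) × J` is the translate of `[−π, 0) × J`). -/
theorem volume_Ico_prod_inter_eq_of_periodic_fst {T : Set (ℝ × ℝ)} (hT : MeasurableSet T)
    (h1 : ∀ p : ℝ × ℝ, (p.1 + 2 * π, p.2) ∈ T ↔ p ∈ T) {J : Set ℝ} (hJ : MeasurableSet J) :
    volume ((Ico (0 : ℝ) (2 * π) ×ˢ J) ∩ T) = volume ((Ico (-π) π ×ˢ J) ∩ T) := by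
  have hπ := Real.pi_pos
  -- split both strips at `π` resp. `0`
  have hsplit₀ : Ico (0 : ℝ) (2 * π) = Ico 0 π ∪ Ico π (2 * π) := (Set.Ico_union_Ico_eq_Ico (by linarith) (by linarith)).symm
  have hsplit₁ : Ico (-π) π = Ico (-π) 0 ∪ Ico 0 π := (Set.Ico_union_Ico_eq_Ico (by linarith) (by linarith)).symm
  have hdisj₀ : Disjoint ((Ico (0 : ℝ) π ×ˢ J) ∩ T) ((Ico π (2 * π) ×ˢ J) ∩ T) :=
    Disjoint.mono inter_subset_left inter_subset_left
      (Set.disjoint_prod.2 (Or.inl (Set.Ico_disjoint_Ico.2 (by simp))))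
  have hdisj₁ : Disjoint ((Ico (-π) (0 : ℝ) ×ˢ J) ∩ T) ((Ico 0 π ×ˢ J) ∩ T) :=
    Disjoint.mono inter_subset_left inter_subset_left
      (Set.disjoint_prod.2 (Or.inl (Set.Ico_disjoint_Ico.2 (by simp))))
  have hmeas : ∀ a b : ℝ, MeasurableSet ((Ico a b ×ˢ J) ∩ T) := fun a b => (measurableSet_Ico.prod hJ).inter hT
  rw [hsplit₀, hsplit₁, Set.union_prod, Set.union_prod, Set.union_inter_distrib_right, Set.union_inter_distrib_right,
    measure_union hdisj₀ (hmeas _ _), measure_union hdisj₁ (hmeas _ _), add_comm (volume ((Ico (-π) (0 : ℝ) ×ˢ J) ∩ T))]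
  congr 1
  -- the strip `[π, 2π) × J ∩ T` is the preimage of `[−π, 0) × J ∩ T` under `q ↦ q + (−2π, 0)`
  have hpre : (Ico π (2 * π) ×ˢ J) ∩ T = (fun q : ℝ × ℝ => q + (-(2 * π), 0)) ⁻¹' ((Ico (-π) 0 ×ˢ J) ∩ T) := by
    ext q
    simp only [Set.mem_inter_iff, Set.mem_prod, Set.mem_Ico, Set.mem_preimage, Prod.fst_add, Prod.snd_add, add_zero]
    have hq : (q.1 + -(2 * π), q.2) ∈ T ↔ q ∈ T := by
      have := h1 (q.1 + -(2 * π), q.2)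
      simp only [neg_add_cancel_right, Prod.mk.eta] at this
      exact this.symm
    rw [show (q + (-(2 * π), 0) ∈ T) ↔ q ∈ T from by rw [show q + (-(2 * π), 0) = (q.1 + -(2 * π), q.2) from Prod.ext rfl (add_zero _)]; exact hq]
    constructor
    · rintro ⟨⟨⟨ha, hb⟩, hJ'⟩, hT'⟩; exact ⟨⟨⟨by linarith, by linarith⟩, hJ'⟩, hT'⟩
    · rintro ⟨⟨⟨ha, hb⟩, hJ'⟩, hT'⟩; exact ⟨⟨⟨by linarith, by linarith⟩, hJ'⟩, hT'⟩
  rw [hpre, measure_preimage_add_right]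

/-- **Periodic window shift**: for a measurable `T ⊆ ℝ²` invariant under both translations by `2π`,
`vol([0,2π)² ∩ T) = vol((−π,π)² ∩ T)`. -/
theorem volume_sq_inter_eq_volume_openSq_inter_of_periodic {T : Set (ℝ × ℝ)} (hT : MeasurableSet T)
    (h1 : ∀ p : ℝ × ℝ, (p.1 + 2 * π, p.2) ∈ T ↔ p ∈ T) (h2 : ∀ p : ℝ × ℝ, (p.1, p.2 + 2 * π) ∈ T ↔ p ∈ T) :
    volume ((Ico (0 : ℝ) (2 * π) ×ˢ Ico (0 : ℝ) (2 * π)) ∩ T) = volume ((Ioo (-π) π ×ˢ Ioo (-π) π) ∩ T) := by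
  -- the swap `(x, y) ↦ (y, x)` preserves Lebesgue measure
  have hswap : ∀ I J : Set ℝ, MeasurableSet I → MeasurableSet J →
      volume ((J ×ˢ I) ∩ Prod.swap ⁻¹' T) = volume ((I ×ˢ J) ∩ T) := by
    intro I J hI hJ
    have h := (Measure.measurePreserving_swap (μ := (volume : Measure ℝ)) (ν := (volume : Measure ℝ))).measure_preimage
      (((hI.prod hJ).inter hT).nullMeasurableSet)
    rw [Set.preimage_inter, Set.preimage_swap_prod] at h
    rw [Measure.volume_eq_prod, ← h]
  have hT' : MeasurableSet (Prod.swap ⁻¹' T) := measurable_swap hT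
  have h1' : ∀ p : ℝ × ℝ, (p.1 + 2 * π, p.2) ∈ Prod.swap ⁻¹' T ↔ p ∈ Prod.swap ⁻¹' T := fun p => by
    have := h2 (p.2, p.1)
    simpa [Set.mem_preimage, Prod.swap] using this
  -- first coordinate, then the second one through the swap
  rw [volume_Ico_prod_inter_eq_of_periodic_fst hT h1 measurableSet_Ico, ← hswap _ _ measurableSet_Ico measurableSet_Ico,
    volume_Ico_prod_inter_eq_of_periodic_fst hT' h1' measurableSet_Ico, hswap _ _ measurableSet_Ico measurableSet_Ico]
  -- the closed-open and the open square differ by a null set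
  exact measure_congr ((Measure.set_prod_ae_eq (Ioo_ae_eq_Ico (μ := (volume : Measure ℝ)))
    (Ioo_ae_eq_Ico (μ := (volume : Measure ℝ)))).symm.inter (ae_eq_refl T))

/-- **Predicate form**: for a measurable, doubly `2π`-periodic predicate `P` on the plane,
`vol{q ∈ [0,2π)² : P q} = vol{q : |q₁| < π ∧ |q₂| < π ∧ P q}` — the window of the co-moving chart (`…C4aLevelChartImage`). -/
theorem volume_sep_sq_eq_volume_openSq_of_periodic {P : ℝ × ℝ → Prop} (hP : MeasurableSet {q | P q})
    (h1 : ∀ q : ℝ × ℝ, P (q.1 + 2 * π, q.2) ↔ P q) (h2 : ∀ q : ℝ × ℝ, P (q.1, q.2 + 2 * π) ↔ P q) :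
    volume {q ∈ Ico (0 : ℝ) (2 * π) ×ˢ Ico (0 : ℝ) (2 * π) | P q} = volume {q : ℝ × ℝ | |q.1| < π ∧ |q.2| < π ∧ P q} := by
  have hA : {q ∈ Ico (0 : ℝ) (2 * π) ×ˢ Ico (0 : ℝ) (2 * π) | P q} = (Ico (0 : ℝ) (2 * π) ×ˢ Ico (0 : ℝ) (2 * π)) ∩ {q | P q} := rfl
  have hB : {q : ℝ × ℝ | |q.1| < π ∧ |q.2| < π ∧ P q} = (Ioo (-π) π ×ˢ Ioo (-π) π) ∩ {q | P q} := by
    ext q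
    simp only [Set.mem_setOf_eq, Set.mem_inter_iff, Set.mem_prod, Set.mem_Ioo, abs_lt, and_assoc]
  rw [hA, hB]
  exact volume_sq_inter_eq_volume_openSq_inter_of_periodic hP h1 h2

end Summit.HubbardSuperconductivity.HubbardSuperconductivity.Theorems.EngineV8

end
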